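import Summits.BirchSwinnertonDyer.BirchSwinnertonDyer.Theorems.ResidualThetaTransportAtTwoResidualSignedLambdaLowerCMAtTwoColemanSideInjective
import HarnessLib

/-!
# The Coleman side of the one-pair count of RSL_g, piece S2 `stub_plusColemanO` — sequel: PUSH (the product-quotient count with FIN derived),
# its providers, and the finite-to-full reduction LIN-X + LIN-C₀ ⟹ LIN (end-to-end: (nz⁺) + LIN-X + LIN-C₀ ⟹ `𝒸 (a•z) = 0 → a = 0`)

Route `ResidualThetaTransportAtTwo` (RTT), crux RSL_g `ResidualSignedLambdaLowerCMAtTwo` (stmt-BirchSwinnertonDyer-22608); width seat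
`prover-bsd-wall-tp2-p2x-w3` g15 (`--supports 22608 --as helper`, closes nothing). THEOREMS ONLY (no definition, no named fact, no
instance, no `sorry`); pure commutative algebra. Stub plan rev 17 S72: card `Ideas/stub-cmlambdalower-k3-g12.md`, sketch
`Cruxes/ResidualThetaCountLowerPureAtTwo/Sketch_sidea_k3_g12.lean` §5, §6, §8, §9 transcribed (credit: stub-ideation k3 g12); §1–§4 and §7 are the
companion file `…ColemanSideInjective.lean`. The maps of `P_S → (P₂ × P_S)/L → P₂/π₁L` are written INLINE:
`L.mkQ ∘ₗ LinearMap.inr A P₂ PS` (`s ↦ [(0, s)]`) and `L.mapQ (L.map (LinearMap.fst A P₂ PS)) (LinearMap.fst A P₂ PS) (le_comap_fst L)`.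

* §5 **PUSH** (`exact_inr_mapQ`, `finite_baseChange_prodQuot`, `finrank_baseChange_prodQuot_eq`, `finite_and_count_prodQuot`): for a sub-lattice
  `L ≤ P₂ × P_S` with `L ∩ (0 × P_S) = 0`, `0 → P_S → (P₂ × P_S)/L → P₂/π₁L → 0`, so FIN and `λ((P₂ × P_S)/L) = λ(P_S) + λ(P₂/π₁L)`; with `π₁L = N|_A`
  this turns (nz⁺), (i_D), FIN(P_S) and the `S₀`-count `f·Σ ≤ λ(P_S)` into FIN and COUNT of the supply.
* §6 providers (`map_fst_span_eq`, `exists_preimage_of_mem_span`, `snd_eq_zero_of_fst_eq_zero`): (hfst) from LIN's set equality, (hL) from INJ.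
* §8 finite-to-full (`eq_zero_of_forall_X_pow_smul`, `apply_X_pow_smul`, `apply_coe_polynomial_smul`, `apply_smul_eq_smul_of_X_of_C`): `A⟦X⟧ⁿ` is
  `X`-adically separated, so LIN-X and LIN-C₀ on a `Λ_𝒪`-submodule give `𝒸 (j s • x) = s • 𝒸 x` for EVERY power series `s`.
* §9 end-to-end (`eq_zero_of_apply_smul_zeta_eq_zero_two_of_X_of_C`): LIN-X + LIN-C₀ + coordinates + (nz⁺) ⟹ `𝒸 (a•z) = 0 → a = 0` at `Λ = ℤ₂⟦X⟧`,
  K0b-free.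

References: [Washington1997] §13.2; [Kobayashi2003] Thm. 7.3, §8 (8.20)–(8.23); [Kato2004Asterisque] Thm. 12.4; [Lang1990] Ch. 5 §1, Ch. 6 §2.
BSD is not proved by any of this; RSL_g (22608) is not proved here.
-/

set_option autoImplicit false
-- the Theorems namespace of this sub repeats the summit name by design (D-0017 nested layout)
set_option linter.dupNamespace false

noncomputable section

open scoped TensorProduct

namespace Summit.BirchSwinnertonDyer.BirchSwinnertonDyer.Theorems.ColemanSideInjective

universe u u' v w

/-! ## §5 PUSH — the product quotient at a sub-lattice `L ≤ P₂ × P_S` with `L ∩ (0 × P_S) = 0`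

The two maps of `P_S → (P₂ × P_S)/L → P₂/π₁L` are written INLINE: `L.mkQ ∘ₗ LinearMap.inr A P₂ PS` (`s ↦ [(0, s)]`) and
`L.mapQ (L.map (LinearMap.fst A P₂ PS)) (LinearMap.fst A P₂ PS) (le_comap_fst L)` (first projection). -/

section ProductQuotient

variable {A : Type u} [CommRing A] (K : Type w) [Field K] [Algebra A K] [IsFractionRing A K]
  {P₂ : Type v} [AddCommGroup P₂] [Module A P₂] {PS : Type v} [AddCommGroup PS] [Module A PS]
  (L : Submodule A (P₂ × PS))

/-- `L ≤ π₁⁻¹(π₁ L)` (well-definedness of the first projection on the quotient). Credit: card k3-g12 §5. [cite: Washington1997, §13.2] -/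
theorem le_comap_fst : L ≤ (L.map (LinearMap.fst A P₂ PS)).comap (LinearMap.fst A P₂ PS) :=
  fun _ hl => Submodule.mem_comap.mpr (Submodule.mem_map_of_mem hl)

/-- `s ↦ [(0, s)]` on elements. Credit: card k3-g12 §5. [cite: Washington1997, §13.2] -/
theorem mkQ_inr_apply (s : PS) : (L.mkQ ∘ₗ LinearMap.inr A P₂ PS) s = Submodule.Quotient.mk ((0 : P₂), s) := rfl

/-- The first projection on classes. Credit: card k3-g12 §5. [cite: Washington1997, §13.2] -/
theorem mapQ_fst_mk (t : P₂ × PS) :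
    L.mapQ (L.map (LinearMap.fst A P₂ PS)) (LinearMap.fst A P₂ PS) (le_comap_fst L) (Submodule.Quotient.mk t) =
      Submodule.Quotient.mk t.1 := rfl

/-- The first projection `(P₂ × P_S)/L → P₂/π₁L` is onto. Credit: card k3-g12 §5. [cite: Washington1997, §13.2] -/
theorem mapQ_fst_surjective :
    Function.Surjective (L.mapQ (L.map (LinearMap.fst A P₂ PS)) (LinearMap.fst A P₂ PS) (le_comap_fst L)) := by
  intro q
  induction q using Submodule.Quotient.induction_on with
  | H y => exact ⟨Submodule.Quotient.mk (y, 0), rfl⟩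

/-- Exactness of `P_S → (P₂ × P_S)/L → P₂/π₁L`. Credit: card k3-g12 §5. [cite: Washington1997, §13.2] -/
theorem exact_inr_mapQ :
    Function.Exact (L.mkQ ∘ₗ LinearMap.inr A P₂ PS)
      (L.mapQ (L.map (LinearMap.fst A P₂ PS)) (LinearMap.fst A P₂ PS) (le_comap_fst L)) := by
  rw [LinearMap.exact_iff]
  apply le_antisymm
  · intro q hq
    induction q using Submodule.Quotient.induction_on with
    | H t =>
      rw [LinearMap.mem_ker, mapQ_fst_mk, Submodule.Quotient.mk_eq_zero] at hq
      obtain ⟨l, hl, hlt⟩ := Submodule.mem_map.mp hq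
      rw [LinearMap.fst_apply] at hlt
      refine ⟨t.2 - l.2, ?_⟩
      rw [mkQ_inr_apply, Submodule.Quotient.eq]
      have h : ((0 : P₂), t.2 - l.2) - t = -l := by
        ext
        · simp [hlt]
        · simp
      rw [h]
      exact L.neg_mem hl
  · rintro _ ⟨s, rfl⟩
    rw [LinearMap.mem_ker, mkQ_inr_apply, mapQ_fst_mk]
    exact (Submodule.Quotient.mk_eq_zero _).mpr (Submodule.zero_mem _)

/-- `s ↦ [(0, s)]` is injective when `L ∩ (0 × P_S) = 0`. Credit: card k3-g12 §5. [cite: Washington1997, §13.2] -/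
theorem mkQ_inr_injective (hL : ∀ l ∈ L, l.1 = 0 → l.2 = 0) : Function.Injective (L.mkQ ∘ₗ LinearMap.inr A P₂ PS) := by
  rw [← LinearMap.ker_eq_bot, eq_bot_iff]
  intro s hs
  rw [LinearMap.mem_ker, mkQ_inr_apply, Submodule.Quotient.mk_eq_zero] at hs
  have := hL _ hs rfl
  simpa using this

/-- **FIN of the product quotient is DERIVED**: `K ⊗ ((P₂ × P_S)/L)` is finite over `K` as soon as `K ⊗ P_S` and `K ⊗ (P₂/π₁L)` are (flat base
change of `P_S → (P₂ × P_S)/L → P₂/π₁L → 0`). Credit: card k3-g12 §5. [cite: Washington1997, §13.2] -/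
theorem finite_baseChange_prodQuot [Module.Finite K (K ⊗[A] PS)]
    [Module.Finite K (K ⊗[A] (P₂ ⧸ L.map (LinearMap.fst A P₂ PS)))] :
    Module.Finite K (K ⊗[A] ((P₂ × PS) ⧸ L)) := by
  haveI : Module.Flat A K := IsLocalization.flat K (nonZeroDivisors A)
  refine Module.Finite.of_exact (f := (L.mkQ ∘ₗ LinearMap.inr A P₂ PS).baseChange K)
    (g := (L.mapQ (L.map (LinearMap.fst A P₂ PS)) (LinearMap.fst A P₂ PS) (le_comap_fst L)).baseChange K) ?_ ?_
  · rw [LinearMap.baseChange_eq_ltensor, LinearMap.baseChange_eq_ltensor]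
    exact Module.Flat.lTensor_exact K (exact_inr_mapQ L)
  · rw [LinearMap.baseChange_eq_ltensor]
    exact LinearMap.lTensor_surjective K (mapQ_fst_surjective L)

/-- **COUNT of the product quotient**: `λ((P₂ × P_S)/L) = λ(P_S) + λ(P₂/π₁L)` when `L ∩ (0 × P_S) = 0` (`0 → P_S → (P₂ × P_S)/L → P₂/π₁L → 0`
and `LambdaLowerBoundO.finrank_baseChange_eq_of_exact_three`). Credit: card k3-g12 §5 (pattern of k1-g8 H10). [cite: Washington1997, §13.2] -/
theorem finrank_baseChange_prodQuot_eq (hL : ∀ l ∈ L, l.1 = 0 → l.2 = 0) [Module.Finite K (K ⊗[A] PS)]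
    [Module.Finite K (K ⊗[A] (P₂ ⧸ L.map (LinearMap.fst A P₂ PS)))] :
    Module.finrank K (K ⊗[A] ((P₂ × PS) ⧸ L)) =
      Module.finrank K (K ⊗[A] PS) + Module.finrank K (K ⊗[A] (P₂ ⧸ L.map (LinearMap.fst A P₂ PS))) := by
  haveI := finite_baseChange_prodQuot K L
  exact Theorems.LambdaLowerBoundO.finrank_baseChange_eq_of_exact_three K (L.mkQ ∘ₗ LinearMap.inr A P₂ PS)
    (L.mapQ (L.map (LinearMap.fst A P₂ PS)) (LinearMap.fst A P₂ PS) (le_comap_fst L)) (mkQ_inr_injective L hL)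
    (exact_inr_mapQ L) (mapQ_fst_surjective L)

/-- **PUSH in the supply's numbers.** With `π₁L = N|_A` for a `Λ`-submodule `N ≤ P₂` (at the pins `P₂ = Λⁿ`, `N = span_Λ (𝒸 '' Λ_𝒪·z)`, so `P₂ ⧸ N = Q`
of (nz⁺)/(i_D)) and `L ∩ (0 × P_S) = 0`: FIN `Module.Finite K (K ⊗ ((P₂ × P_S)/L))` and COUNT `f·(d+Σ+e) ≤ λ((P₂ × P_S)/L)` follow from (nz⁺)
`Module.Finite K (K ⊗ Q)`, (i_D) `f·(d+e) ≤ λ(Q)`, FIN(P_S) and the `S₀`-count `f·Σ ≤ λ(P_S)` (S1⊕). Credit: card k3-g12 §5.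
[cite: Washington1997, §13.2] [cite: Kobayashi2003, Thm. 7.3] -/
theorem finite_and_count_prodQuot {Λ : Type u'} [Ring Λ] [Module Λ P₂] [SMul A Λ] [IsScalarTower A Λ P₂]
    (N : Submodule Λ P₂) (hfst : L.map (LinearMap.fst A P₂ PS) = N.restrictScalars A)
    (hL : ∀ l ∈ L, l.1 = 0 → l.2 = 0)
    [Module.Finite K (K ⊗[A] (P₂ ⧸ N))] [Module.Finite K (K ⊗[A] PS)]
    {f d e σ : ℕ} (hQ : f * (d + e) ≤ Module.finrank K (K ⊗[A] (P₂ ⧸ N)))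
    (hS : f * σ ≤ Module.finrank K (K ⊗[A] PS)) :
    Module.Finite K (K ⊗[A] ((P₂ × PS) ⧸ L)) ∧
      f * (d + σ + e) ≤ Module.finrank K (K ⊗[A] ((P₂ × PS) ⧸ L)) := by
  let e₁ : (P₂ ⧸ L.map (LinearMap.fst A P₂ PS)) ≃ₗ[A] (P₂ ⧸ N) :=
    (Submodule.quotEquivOfEq _ _ hfst).trans (Submodule.Quotient.restrictScalarsEquiv A N)
  haveI : Module.Finite K (K ⊗[A] (P₂ ⧸ L.map (LinearMap.fst A P₂ PS))) :=
    Module.Finite.equiv (e₁.baseChange A K _ _).symm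
  have hrk : Module.finrank K (K ⊗[A] (P₂ ⧸ L.map (LinearMap.fst A P₂ PS))) =
      Module.finrank K (K ⊗[A] (P₂ ⧸ N)) := (e₁.baseChange A K _ _).finrank_eq
  refine ⟨finite_baseChange_prodQuot K L, ?_⟩
  rw [finrank_baseChange_prodQuot_eq K L hL, hrk]
  have : f * (d + σ + e) = f * σ + f * (d + e) := by ring
  omega

end ProductQuotient

/-! ## §6 The two hypotheses of PUSH from LIN (set equality) and INJ (injectivity) -/

section Providers

/-- **(hfst) from LIN**: if the image SET `𝒸 '' Z` is the carrier of a `Λ`-submodule `N` (`image_eq_range_present`), then the first projection of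
`span_A ((𝒸, locS) '' Z)` is `N|_A`. Credit: card k3-g12 §6. [cite: Washington1997, §13.2] -/
theorem map_fst_span_eq {A : Type*} [CommSemiring A] {Λ : Type*} [Semiring Λ]
    {V : Type*} [AddCommGroup V] [Module A V] [Module Λ V] [SMul A Λ] [IsScalarTower A Λ V]
    {PS : Type*} [AddCommGroup PS] [Module A PS] {H : Type*}
    (c : H → V) (lS : H → PS) (Z : Set H) (N : Submodule Λ V) (hN : c '' Z = (N : Set V)) :
    (Submodule.span A ((fun x => (c x, lS x)) '' Z)).map (LinearMap.fst A V PS) = N.restrictScalars A := by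
  rw [Submodule.map_span, Set.image_image]
  have himg : (fun x => (LinearMap.fst A V PS) (c x, lS x)) '' Z = c '' Z :=
    Set.image_congr fun x _ => by simp
  rw [himg, hN]
  exact Submodule.span_eq (N.restrictScalars A)

/-- Elements of `span_A (locd '' Z)` are values `locd x`, `x ∈ Z`, when `Z` is `A`-saturated through `locd` (at the pins:
`locd (padicIntToCoeffIntegers _ a • x) = a • locd x` and `Z = Λ_𝒪·z` an `𝒪`-submodule). Credit: card k3-g12 §6. [cite: Washington1997, §13.2] -/
theorem exists_preimage_of_mem_span {A : Type*} [Semiring A] {W : Type*} [AddCommGroup W] [Module A W]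
    {H : Type*} [AddCommGroup H] (locd : H →+ W) (Z : AddSubgroup H)
    (hZ : ∀ (a : A) (x : H), x ∈ Z → ∃ x' ∈ Z, locd x' = a • locd x)
    {l : W} (hl : l ∈ Submodule.span A (locd '' (Z : Set H))) : ∃ x ∈ Z, locd x = l := by
  induction hl using Submodule.span_induction with
  | mem w hw =>
    obtain ⟨x, hx, rfl⟩ := hw
    exact ⟨x, hx, rfl⟩
  | zero => exact ⟨0, Z.zero_mem, map_zero locd⟩
  | add u w _ _ hu hw =>
    obtain ⟨x, hx, rfl⟩ := hu
    obtain ⟨y, hy, rfl⟩ := hw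
    exact ⟨x + y, Z.add_mem hx hy, map_add locd x y⟩
  | smul a w _ hw =>
    obtain ⟨x, hx, rfl⟩ := hw
    exact hZ a x hx

/-- **(hL) from INJ**: `span_A (locd '' Z) ∩ (0 × P_S) = 0` once `𝒸 = π₁ ∘ locd` is injective on `Z` (`injOn_span_zeta`). Credit: card k3-g12 §6.
[cite: Washington1997, §13.2] -/
theorem snd_eq_zero_of_fst_eq_zero {A : Type*} [Semiring A] {V : Type*} [AddCommGroup V] [Module A V]
    {PS : Type*} [AddCommGroup PS] [Module A PS] {H : Type*} [AddCommGroup H]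
    (locd : H →+ V × PS) (Z : AddSubgroup H)
    (hZ : ∀ (a : A) (x : H), x ∈ Z → ∃ x' ∈ Z, locd x' = a • locd x)
    (hinjZ : ∀ x ∈ Z, (locd x).1 = 0 → x = 0) :
    ∀ l ∈ Submodule.span A (locd '' (Z : Set H)), l.1 = 0 → l.2 = 0 := by
  intro l hl h1
  obtain ⟨x, hx, rfl⟩ := exists_preimage_of_mem_span locd Z hZ hl
  have hx0 := hinjZ x hx h1
  subst hx0
  rw [map_zero]
  rfl

end Providers

/-! ## §8 The finite-to-full reduction: LIN-X + LIN-C₀ already give `Λ`-linearity on `Λ_𝒪·z`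

No topology on `I.H` is needed: the VALUES of `𝒸` are power series, and `Λⁿ = A⟦X⟧ⁿ` is `X`-adically separated (coefficientwise). So the
single-step identities `𝒸 (X•x) = X•𝒸 x` (LIN-X: `proj_T_smul` + conjugation-equivariance of the pinned pairing + the landed Coleman twist) and
`𝒸 (C a•x) = C a•𝒸 x` for constants `a ∈ A = ℤ₂` (LIN-C₀: the supply's own `ℤ₂`-semilinearity binder of `locd` + `col` linear) imply `hsemi` with
`φ = id` for EVERY power series `s`. -/

section FiniteToFull

variable {A : Type*} [CommRing A] {ΛO : Type*} [CommRing ΛO] {H : Type*} [AddCommGroup H] [Module ΛO H]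
  {V : Type*} [AddCommGroup V] [Module (PowerSeries A) V]

/-- `X`-ADIC SEPARATEDNESS of `A⟦X⟧ⁿ`: an `n`-tuple of power series divisible by every power of `X` is `0` (compare coefficients).
Credit: card k3-g12 §8. [cite: Lang1990, Ch. 5 §1 (p. 94)] -/
theorem eq_zero_of_forall_X_pow_smul {n : ℕ} (v : Fin n → PowerSeries A)
    (h : ∀ N : ℕ, ∃ w : Fin n → PowerSeries A, v = (PowerSeries.X : PowerSeries A) ^ N • w) : v = 0 := by
  funext i
  ext m
  obtain ⟨w, hw⟩ := h (m + 1)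
  have hvi : v i = (PowerSeries.X : PowerSeries A) ^ (m + 1) * w i := by
    rw [hw]; rfl
  rw [hvi, PowerSeries.coeff_X_pow_mul', if_neg (by omega)]
  simp

/-- LIN-X iterated: `𝒸 ((j X)^N • x) = X^N • 𝒸 x` on the submodule `S`. Credit: card k3-g12 §8. [cite: Lang1990, Ch. 6 §2 (p. 111)] -/
theorem apply_X_pow_smul (j : PowerSeries A →+* ΛO) (𝒸 : H →+ V) (S : Submodule ΛO H)
    (hX : ∀ x ∈ S, 𝒸 (j PowerSeries.X • x) = (PowerSeries.X : PowerSeries A) • 𝒸 x) (N : ℕ) :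
    ∀ x ∈ S, 𝒸 ((j PowerSeries.X) ^ N • x) = (PowerSeries.X : PowerSeries A) ^ N • 𝒸 x := by
  induction N with
  | zero => intro x _; simp
  | succ N ih =>
      intro x hx
      rw [pow_succ, mul_smul, ih _ (S.smul_mem _ hx), hX x hx, pow_succ, mul_smul]

/-- LIN-X + LIN-C₀ give the identity for every POLYNOMIAL `p ∈ A[X]`. Credit: card k3-g12 §8. [cite: Lang1990, Ch. 6 §2 (p. 111)] -/
theorem apply_coe_polynomial_smul (j : PowerSeries A →+* ΛO) (𝒸 : H →+ V) (S : Submodule ΛO H)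
    (hX : ∀ x ∈ S, 𝒸 (j PowerSeries.X • x) = (PowerSeries.X : PowerSeries A) • 𝒸 x)
    (hC : ∀ (a : A), ∀ x ∈ S, 𝒸 (j (PowerSeries.C a) • x) = (PowerSeries.C a : PowerSeries A) • 𝒸 x)
    (p : Polynomial A) : ∀ x ∈ S, 𝒸 (j (p : PowerSeries A) • x) = (p : PowerSeries A) • 𝒸 x := by
  induction p using Polynomial.induction_on' with
  | add p q hp hq =>
      intro x hx
      rw [Polynomial.coe_add, map_add, add_smul, map_add, hp x hx, hq x hx, add_smul]
  | monomial k a =>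
      intro x hx
      rw [← Polynomial.C_mul_X_pow_eq_monomial, Polynomial.coe_mul, Polynomial.coe_pow, Polynomial.coe_C,
        Polynomial.coe_X, map_mul, map_pow, mul_smul,
        hC a _ (S.smul_mem _ hx), apply_X_pow_smul j 𝒸 S hX k x hx, ← mul_smul]

/-- **Finite-to-full (PROVED).** If `V` is `X`-adically separated, LIN-X and LIN-C₀ on a `Λ_𝒪`-submodule `S` imply `𝒸 (j s • x) = s • 𝒸 x` for EVERY
power series `s` and every `x ∈ S` — i.e. `hsemi` with `φ = id`. Proof: `s = trunc_N s + X^N·t`, the polynomial case, LIN-X iterated; the defect is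
divisible by every `X^N`. Credit: card k3-g12 §8. [cite: Lang1990, Ch. 6 §2 (p. 111)] -/
theorem apply_smul_eq_smul_of_X_of_C
    (hV : ∀ v : V, (∀ N : ℕ, ∃ w : V, v = (PowerSeries.X : PowerSeries A) ^ N • w) → v = 0)
    (j : PowerSeries A →+* ΛO) (𝒸 : H →+ V) (S : Submodule ΛO H)
    (hX : ∀ x ∈ S, 𝒸 (j PowerSeries.X • x) = (PowerSeries.X : PowerSeries A) • 𝒸 x)
    (hC : ∀ (a : A), ∀ x ∈ S, 𝒸 (j (PowerSeries.C a) • x) = (PowerSeries.C a : PowerSeries A) • 𝒸 x)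
    (s : PowerSeries A) : ∀ x ∈ S, 𝒸 (j s • x) = s • 𝒸 x := by
  intro x hx
  rw [← sub_eq_zero]
  apply hV
  intro N
  -- `s = trunc_N s + X^N * t`
  have hdvd : (PowerSeries.X : PowerSeries A) ^ N ∣ s - (PowerSeries.trunc N s : PowerSeries A) := by
    rw [PowerSeries.X_pow_dvd_iff]
    intro m hm
    rw [map_sub, Polynomial.coe_def] at *
    simp [PowerSeries.coeff_trunc, hm]
  obtain ⟨t, ht⟩ := hdvd
  have hs : s = (PowerSeries.trunc N s : PowerSeries A) + (PowerSeries.X : PowerSeries A) ^ N * t := by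
    rw [← ht]; ring
  refine ⟨𝒸 (j t • x) - t • 𝒸 x, ?_⟩
  conv_lhs => rw [hs]
  rw [map_add, add_smul, map_add, apply_coe_polynomial_smul j 𝒸 S hX hC _ x hx, map_mul, map_pow, mul_smul,
    apply_X_pow_smul j 𝒸 S hX N _ (S.smul_mem _ hx), add_smul, mul_smul, smul_sub]
  abel

end FiniteToFull

/-! ## §9 End-to-end at the pins' shape: LIN-X + LIN-C₀ + (nz⁺) ⟹ `𝒸 (a•z) = 0 → a = 0` (U52 (b), K0b-free) -/

section EndToEnd

/-- **U52 (b) from (nz⁺) + the two single-step identities, at `Λ = ℤ₂⟦X⟧` (PROVED).** Inputs: LIN-X, LIN-C₀ on `Λ_𝒪·z`; `ℤ₂⟦X⟧`-coordinates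
(`bvec`, `crd`, `hsum`) of `Λ_𝒪` along `j`; (nz⁺). Output: `a•z ∈ ker 𝒸 → a = 0` for all `a ∈ Λ_𝒪` — hence `𝒸` is injective on `Λ_𝒪·z` AND `z` is
non-torsion, with NO appeal to Kato 12.4 (2) (K0b). Credit: card k3-g12 §9. [cite: Washington1997, §13.2] [cite: Kato2004Asterisque, Thm. 12.4] -/
theorem eq_zero_of_apply_smul_zeta_eq_zero_two_of_X_of_C {ΛO : Type u'} [CommRing ΛO] {H : Type v} [AddCommGroup H]
    [Module ΛO H] {n : ℕ} (j : PowerSeries ℤ_[2] →+* ΛO) (𝒸 : H →+ (Fin n → PowerSeries ℤ_[2])) (z : H)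
    (hX : ∀ x ∈ Submodule.span ΛO ({z} : Set H),
      𝒸 (j PowerSeries.X • x) = (PowerSeries.X : PowerSeries ℤ_[2]) • 𝒸 x)
    (hC : ∀ (a : ℤ_[2]), ∀ x ∈ Submodule.span ΛO ({z} : Set H),
      𝒸 (j (PowerSeries.C a) • x) = (PowerSeries.C a : PowerSeries ℤ_[2]) • 𝒸 x)
    (bvec : Fin n → ΛO) (crd : ΛO →+ (Fin n → PowerSeries ℤ_[2])) (hsum : ∀ a : ΛO, ∑ i, j (crd a i) * bvec i = a)
    [Module.Finite ℚ_[2] (ℚ_[2] ⊗[ℤ_[2]] ((Fin n → PowerSeries ℤ_[2]) ⧸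
      Submodule.span (PowerSeries ℤ_[2]) (𝒸 '' (Submodule.span ΛO ({z} : Set H) : Set H))))]
    (a : ΛO) (ha : 𝒸 (a • z) = 0) : a = 0 :=
  eq_zero_of_apply_smul_zeta_eq_zero_two j 𝒸 z (RingEquiv.refl _)
    (fun s x hx => by
      rw [RingEquiv.refl_apply]
      exact apply_smul_eq_smul_of_X_of_C eq_zero_of_forall_X_pow_smul j 𝒸 _ hX hC s x hx)
    bvec crd hsum a ha

end EndToEnd

end Summit.BirchSwinnertonDyer.BirchSwinnertonDyer.Theorems.ColemanSideInjective

end
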